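import Summits.MatrixMultiplication.MatrixMultiplication.Theorems.FarEdgeDescentCornerZeroSet

/-!
# Route `FarEdgeDescent`, special leaf `FiniteSaturation`: folding a saturated shape (the fold region of `Z`)

Support module (def-free, kernel only) for crux `FiniteSaturation` (stmt-MatrixMultiplication-23739) of
`Summits/MatrixMultiplication/MatrixMultiplication/Theses/FarEdgeDescent.lean`; the cut of record
`ω = 2 ⟺ FiniteSaturation ∧ AnchoredLogConvexity` is unchanged.  Cell `decomp-mm`, lens 2 (structural
dichotomy special / generic), generation 13 — companion of `FarEdgeDescentCornerZeroSet` (the zero set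
`Z = {(a,c) ∈ [0,1]² : ω(a,1,c) = 1 + max a c}` of the excess at the far corner).

ONE MOVE, the FOLD.  If a shape is saturated in an information bound, `ω(x,y,z) ≤ x + z`, glue it with its
mirror image `(z,y,x)` (Lotti–Romani subadditivity): the shape `(x+z, 2y, x+z)` costs `2(x+z)`, i.e. after
rescaling one gets the DUAL ZERO `ω(1, 2y/(x+z), 1) = 2`; gluing all three rotations instead gives the cube.
* `alpha_ge_fold`: `ω(x,y,z) ≤ x + z ⟹ 2y/(x+z) ≤ α` (any field);
* `sum_mul_omega_le_three_mul_omegaRect`: `(x+y+z)·ω ≤ 3·ω(x,y,z)` for REAL `x, y, z ≥ 0` (any field; the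
  tree has the integer shapes, `SoloInformedLadderSymmetrization.omega_mul_le_three_mul_omegaRect_nat`,
  and the line `(1,a,1)`, `RectangularBarrierProofs.omega_mul_le_three_mul_omegaRect`), whence
  `omega_le_fold`: `ω(x,y,z) ≤ x + z ⟹ ω ≤ 3(x+z)/(x+y+z)`.

The three saturated families of the cell are instances of the one lemma:
* ROOFS `ω(1,k,1) = k + 1` (shape `(k,1,1)`): `α ≥ 2/(k+1)` — this is generation 8's
  `FarEdgeDescentAlphaPrice.alpha_ge_of_saturated`, re-derived below as an `example`, not restated — and
  `ω ≤ 3(k+1)/(k+2)` (`FarEdgeDescentSpectralEdge.omega_le_of_roof`);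
* POINTS OF `Z`, `ω(a,1,c) = 1 + c` with `0 ≤ a ≤ c` (shape `(1,a,c)`): `α ≥ 2a/(1+c)` (`sat_fold`) and
  `ω ≤ 3(1+c)/(1+a+c)` (`omega_le_sat`).  CORRECTION OF EMPHASIS in `FarEdgeDescentCornerZeroSet`: its
  `sat_strip` (`a ≤ α`) and `roof_le_alpha` (`1/k ≤ α`) are true but DOMINATED — `a ≤ 2a/(1+c)` on `c ≤ 1`
  with equality only on the top edge (`strip_le_fold`), and `1/k < 2/(k+1)` for `k > 1`; the example in that
  docstring should read "a roof at any `k ≤ 5` gives `α ≥ 1/3 > 0.321334`" (generation 8).  So on the side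
  `a ≤ c` the zero set lies in the FOLD REGION `{2a ≤ α(1+c)}` — the strip at the top edge, HALF the strip
  at the corner — and contains Coppersmith's wedge `{a ≤ αc}` (`sat_wedge`); both bounds are exact on the
  top edge: `Z ∩ {c = 1} = [0, α] × {1}` (`sat_top_iff`);
* TIGHT PAIRS of the saturation ladder (lens 1), `ω(1,t,r) ≤ 1 + r` (shape `(1,t,r)`): `α ≥ 2t/(1+r)`
  (`tight_fold`, dominating `tight_le_alpha`'s `t/r` for `r ≥ 1`, `ratio_le_fold`) and
  `ω ≤ 3(1+r)/(1+t+r)` (`omega_le_tight`): the ladder `r(t)` satisfies `r(t) ≥ 2t/α − 1`.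
Nothing here is deep: the point is that ONE fold prices every saturated shape of the three lineages (far
edge, corner zero set, saturation ladder), and that the fold region, not the strip, is the right outer bound
of `Z` on each side of the diagonal.
[cite: LottiRomani1983, §1 (p. 173)] [cite: LeGall2012, §1] [cite: Blaser2013, Theorem 5.9]
-/

set_option linter.dupNamespace false

namespace Summit.MatrixMultiplication.MatrixMultiplication.Theorems.FarEdgeDescentCornerFold

open Literature.Computability.AlgebraicComplexity
open Summit.MatrixMultiplication.MatrixMultiplication.Theorems.FarEdgeDescentCornerZeroSet

section AnyField

variable (K : Type) [Field K]

/-- **The fold.** A shape saturated in the information bound of its outer slots, `ω(x,y,z) ≤ x + z`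
(`y ≥ 0`, `x + z > 0`), certifies the dual zero `ω(1, 2y/(x+z), 1) = 2`, hence `2y/(x+z) ≤ α`:
glue `(x,y,z)` with `(z,y,x)` (subadditivity) and rescale by `x + z` (homogeneity).
[cite: LottiRomani1983, §1 (p. 173)] -/
theorem alpha_ge_fold {x y z : ℝ} (hy : 0 ≤ y) (hxz : 0 < x + z) (h : omegaRect K x y z ≤ x + z) :
    2 * y / (x + z) ≤ dualExponentAlpha K := by
  have h' : omegaRect K z y x ≤ x + z := by rwa [omegaRect_swap₁₃ K z y x]
  have hsub := LottiRomani1983_subadditive K x y z z y x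
  rw [show z + x = x + z from add_comm z x, ← two_mul] at hsub
  have hhom := LottiRomani1983_homogeneous K (ν := x + z) (x := 1) (y := 2 * y / (x + z)) (z := 1)
    hxz.le zero_le_one (div_nonneg (mul_nonneg zero_le_two hy) hxz.le) zero_le_one
  rw [mul_one, mul_div_cancel₀ (2 * y) hxz.ne'] at hhom
  have hle : (x + z) * omegaRect K 1 (2 * y / (x + z)) 1 ≤ (x + z) * 2 := by
    rw [← hhom]; linarith
  exact le_dualExponentAlpha_of_omegaRect_eq_two K
    (le_antisymm (le_of_mul_le_mul_left hle hxz) (two_le_omegaRect_one_mid_one K _))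

/-- **Symmetrisation for real shapes**: `(x+y+z)·ω ≤ 3·ω(x,y,z)` for `x, y, z ≥ 0` — glue the three
rotations of `(x,y,z)` (subadditivity twice) and rescale the cube `(s,s,s)`, `s = x+y+z` (homogeneity).
[cite: Blaser2013, Theorem 5.9] -/
theorem sum_mul_omega_le_three_mul_omegaRect {x y z : ℝ} (hx : 0 ≤ x) (hy : 0 ≤ y) (hz : 0 ≤ z) :
    (x + y + z) * omega K ≤ 3 * omegaRect K x y z := by
  have h1 := LottiRomani1983_subadditive K x y z y z x
  have h2 := LottiRomani1983_subadditive K (x + y) (y + z) (z + x) z x y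
  have p1 : omegaRect K y z x = omegaRect K x y z := by
    rw [omegaRect_swap₁₃ K y z x, omegaRect_swap₂₃ K x z y]
  have p2 : omegaRect K z x y = omegaRect K x y z := by
    rw [omegaRect_swap₁₂ K z x y, omegaRect_swap₂₃ K x z y]
  have hhom := LottiRomani1983_homogeneous K (ν := x + y + z) (x := 1) (y := 1) (z := 1)
    (by linarith) zero_le_one zero_le_one zero_le_one
  rw [mul_one, omegaRect_one_one_one] at hhom
  rw [show y + z + x = x + y + z by ring, show z + x + y = x + y + z by ring, hhom, p2] at h2
  rw [p1] at h1
  linarith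

/-- **ω-price of a fold**: `ω(x,y,z) ≤ x + z ⟹ ω ≤ 3(x+z)/(x+y+z)`. [cite: Blaser2013, Theorem 5.9] -/
theorem omega_le_fold {x y z : ℝ} (hx : 0 ≤ x) (hy : 0 ≤ y) (hz : 0 ≤ z) (hs : 0 < x + y + z)
    (h : omegaRect K x y z ≤ x + z) : omega K ≤ 3 * (x + z) / (x + y + z) := by
  rw [le_div_iff₀ hs]
  have := sum_mul_omega_le_three_mul_omegaRect K hx hy hz
  calc omega K * (x + y + z) = (x + y + z) * omega K := mul_comm _ _
    _ ≤ 3 * omegaRect K x y z := this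
    _ ≤ 3 * (x + z) := by linarith

end AnyField

/-! ## The fold region of the corner zero set `Z` -/

/-- **Fold bound**: a point of `Z` on the side `0 ≤ a ≤ c` has `2a/(1+c) ≤ α` (shape `(1,a,c)` is
saturated in slots 1, 3).  At `c = 1` this is the strip `a ≤ α`; at the corner it is half of it. [cite: LeGall2012, §1] -/
theorem sat_fold {a c : ℝ} (ha : 0 ≤ a) (hac : a ≤ c) (h : omegaRect ℂ a 1 c = 1 + max a c) :
    2 * a / (1 + c) ≤ dualExponentAlpha ℂ := by
  have h1 : omegaRect ℂ 1 a c ≤ 1 + c := by rw [omegaRect_swap₁₂ ℂ 1 a c, h, max_eq_right hac]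
  exact alpha_ge_fold ℂ ha (by linarith) h1

/-- Fold bound on the other side `0 ≤ c ≤ a`: `2c/(1+a) ≤ α`. [cite: LeGall2012, §1] -/
theorem sat_fold' {a c : ℝ} (hc : 0 ≤ c) (hca : c ≤ a) (h : omegaRect ℂ a 1 c = 1 + max a c) :
    2 * c / (1 + a) ≤ dualExponentAlpha ℂ :=
  sat_fold hc hca (sat_symm.1 h)

/-- On the diagonal the fold reads `(s,s) ∈ Z ⟹ 2s/(1+s) ≤ α`, i.e. `s ≤ α/(2 − α)`; with `s = 1/k` this
is generation 8's `α ≥ 2/(k+1)`. [cite: LeGall2012, §1] -/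
theorem diag_fold {s : ℝ} (hs : 0 ≤ s) (h : omegaRect ℂ s 1 s = 1 + max s s) :
    2 * s / (1 + s) ≤ dualExponentAlpha ℂ :=
  sat_fold hs le_rfl h

/-- The roof instance of the fold (shape `(k,1,1)`) is exactly `FarEdgeDescentAlphaPrice.alpha_ge_of_saturated`
(`ω(1,k,1) = k+1 ⟹ 2/(k+1) ≤ α`); recorded as an `example`, not restated. -/
example {k : ℝ} (hk : 0 < k) (h : omegaRect ℂ 1 k 1 = k + 1) : 2 / (k + 1) ≤ dualExponentAlpha ℂ := by
  have h1 : omegaRect ℂ k 1 1 ≤ k + 1 := by rw [omegaRect_swap₁₂ ℂ k 1 1, h]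
  have := alpha_ge_fold ℂ zero_le_one (by linarith) h1
  rwa [mul_one] at this

/-- The fold dominates the strip of `FarEdgeDescentCornerZeroSet.sat_strip`: `a ≤ 2a/(1+c)` whenever
`a ≥ 0` and `-1 < c ≤ 1`, with equality iff `a = 0` or `c = 1`. -/
theorem strip_le_fold {a c : ℝ} (ha : 0 ≤ a) (hc : -1 < c) (hc1 : c ≤ 1) : a ≤ 2 * a / (1 + c) := by
  rw [le_div_iff₀ (by linarith)]
  nlinarith [mul_nonneg ha (sub_nonneg.2 hc1)]

/-- **The top edge of `Z` is exactly `[0, α]`**: for `a ≤ 1`, `(a,1) ∈ Z ⟺ ω(1,a,1) = 2 ⟺ a ≤ α` — the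
wedge `{a ≤ αc}` (inner bound, `sat_wedge`) and the fold region `{2a ≤ α(1+c)}` (outer bound, `sat_fold`)
both cut the edge `c = 1` in this segment. [cite: LeGall2012, §1] -/
theorem sat_top_iff {a : ℝ} (ha1 : a ≤ 1) :
    omegaRect ℂ a 1 1 = 1 + max a 1 ↔ a ≤ dualExponentAlpha ℂ := by
  rw [max_eq_right ha1, omegaRect_swap₁₂ ℂ a 1 1, show (1 : ℝ) + 1 = 2 by norm_num]
  exact ⟨le_dualExponentAlpha_of_omegaRect_eq_two ℂ, omegaRect_eq_two_of_le_dualExponentAlpha ℂ⟩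

/-- **ω-price of a point of `Z`**: `ω(a,1,c) = 1 + c`, `0 ≤ a ≤ c` ⟹ `ω ≤ 3(1+c)/(1+a+c)`; on the
diagonal `a = c = 1/k` this is `ω ≤ 3(k+1)/(k+2)` (`FarEdgeDescentSpectralEdge.omega_le_of_roof`).
[cite: Blaser2013, Theorem 5.9] -/
theorem omega_le_sat {a c : ℝ} (ha : 0 ≤ a) (hac : a ≤ c) (h : omegaRect ℂ a 1 c = 1 + max a c) :
    omega ℂ ≤ 3 * (1 + c) / (1 + a + c) := by
  have h1 : omegaRect ℂ 1 a c ≤ 1 + c := by rw [omegaRect_swap₁₂ ℂ 1 a c, h, max_eq_right hac]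
  exact omega_le_fold ℂ zero_le_one ha (ha.trans hac) (by linarith) h1

/-! ## Tight pairs of the saturation ladder (junction with lens 1) -/

/-- **Fold of a tight pair**: `ω(1,t,r) ≤ 1 + r` (`t, r ≥ 0`) ⟹ `2t/(1+r) ≤ α`; equivalently the
saturation ladder satisfies `r ≥ 2t/α − 1`. [cite: LeGall2012, §1] -/
theorem tight_fold {t r : ℝ} (ht : 0 ≤ t) (hr : 0 ≤ r) (h : omegaRect ℂ 1 t r ≤ 1 + r) :
    2 * t / (1 + r) ≤ dualExponentAlpha ℂ :=
  alpha_ge_fold ℂ ht (by linarith) h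

/-- The fold dominates `FarEdgeDescentCornerZeroSet.tight_le_alpha`: `t/r ≤ 2t/(1+r)` for `t ≥ 0`, `r ≥ 1`. -/
theorem ratio_le_fold {t r : ℝ} (ht : 0 ≤ t) (hr : 1 ≤ r) : t / r ≤ 2 * t / (1 + r) := by
  rw [div_le_div_iff₀ (by linarith) (by linarith)]
  nlinarith [mul_nonneg ht (sub_nonneg.2 hr)]

/-- **ω-price of a tight pair**: `ω(1,t,r) ≤ 1 + r` (`t, r ≥ 0`) ⟹ `ω ≤ 3(1+r)/(1+t+r)`.
[cite: Blaser2013, Theorem 5.9] -/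
theorem omega_le_tight {t r : ℝ} (ht : 0 ≤ t) (hr : 0 ≤ r) (h : omegaRect ℂ 1 t r ≤ 1 + r) :
    omega ℂ ≤ 3 * (1 + r) / (1 + t + r) :=
  omega_le_fold ℂ zero_le_one ht hr (by linarith) h

end Summit.MatrixMultiplication.MatrixMultiplication.Theorems.FarEdgeDescentCornerFold
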